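import Mathlib
import HarnessLib
import Summits.NavierStokesRegularity.NavierStokesRegularity.Theorems.UnthreadedDoorNetFluxStratumReduction

/-!
# Route `UnthreadedDoor`, crux `PoloidalLiouville` (stmt-NavierStokesRegularity-1222), WALL W1 — crux idea «indicatrix-bound», Λ-4 tooling:
# the PER-DATA tail «window decay of the cumulative net flux ⇒ radial gradient»

★ `cross_gradient_eq_zero_of_netFluxWindowBound` — ARM A's HH-5 tail (p660934, as re-run over a stratum in `NetFlux.scalarLiouvilleTypeIOn_of_netFluxWindowDecayOn`,
p678536) with the window bound stated for ONE datum `(x₀, T)` at ONE time `t < 0` and an ARBITRARY radius profile `K R` in place of the uniform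
`A · C₁ · (1 + R/√(−t))³`: if `∫₀ᴿ netFlux (T t) ≤ K(R) · (t/t₁)^λ` for every `t₁ ≤ t` and every `R > 0` (`λ > 0`), then `∇T(t) × (x − x₀) = 0`
everywhere.  WHY: the count-free chain Λ-4 (`IndicatrixSketch.lean` v1.7.3) delivers the decay with the DATA-DEPENDENT constant `A (C₁ + C₂)` (`C₂` = the
Type-I Hessian constant of `v`), which the uniform interface `NetFluxWindowDecayOn S` (`A · C₁`, `A` fixed before the data) cannot carry.  Proof verbatim:
`t₁ → −∞` ⇒ `∫₀ᴿ netFlux ≤ 0` ⇒ the continuous nonnegative bounded density vanishes ⇒ `T t` constant on spheres ⇒ radial gradient.  Nothing here is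
an NS statement; ⟨1222⟩ / W1 / NS regularity OPEN.  `--supports stmt-NavierStokesRegularity-1222 --as helper`.  [folklore]
-/

noncomputable section

-- the summit and its single sub-problem share the name (CONVENTIONS §1)
set_option linter.dupNamespace false

namespace Summit.NavierStokesRegularity.NavierStokesRegularity.Theorems.PoloidalLiouville.Indicatrix

open MeasureTheory Filter Set Function Metric
open scoped Topology RealInnerProductSpace InnerProductSpace
open Literature.Analysis Literature.Analysis.FluidPDE
open Summit.NavierStokesRegularity.NavierStokesRegularity.Theorems.PoloidalLiouville.NetFlux

/-- ★ **Per-data tail: a window bound `∫₀ᴿ netFlux (T t) ≤ K(R) (t/t₁)^λ` for all `t₁ ≤ t`, `R > 0` forces `∇T(t) × (x − x₀) = 0`** (`T` smooth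
off the centre line on the slab, bounded). [folklore] -/
theorem cross_gradient_eq_zero_of_netFluxWindowBound {x₀ : E3} {T : ℝ → E3 → ℝ}
    (hsT : ContDiffOn ℝ (⊤ : ℕ∞) (uncurry T) (Iio 0 ×ˢ ({x₀}ᶜ : Set E3)))
    (hTb : ∃ C : ℝ, ∀ t < 0, ∀ x, |T t x| ≤ C) {t : ℝ} (ht : t < 0) {lam : ℝ} (hlam : 0 < lam) (K : ℝ → ℝ)
    (hwin : ∀ t₁ : ℝ, t₁ ≤ t → ∀ R : ℝ, 0 < R → ∫ r in Ioo 0 R, netFlux (T t) x₀ r ≤ K R * (t / t₁) ^ lam) :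
    ∀ x, cross (gradient (T t) x) (x - x₀) = 0 := by
  intro x
  obtain ⟨CT, hCT⟩ := hTb
  -- ### letting `t₁ → −∞`: the integrals are `≤ 0`
  have hint : ∀ R : ℝ, 0 < R → ∫ r in Ioo 0 R, netFlux (T t) x₀ r ≤ 0 := by
    intro R hR
    set D : ℝ := K R with hD
    refine le_of_forall_pos_le_add fun δ hδ => ?_
    rw [zero_add]
    -- choose `t₁ ≤ t` with `|D| (t/t₁)^λ ≤ δ`
    set m : ℝ := min ((δ / (|D| + 1)) ^ (1 / lam)) 1 with hm
    have hq0 : 0 < δ / (|D| + 1) := div_pos hδ (by positivity)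
    have hm0 : 0 < m := lt_min (Real.rpow_pos_of_pos hq0 _) one_pos
    have hm1 : m ≤ 1 := min_le_right _ _
    set t₁ : ℝ := t / m with ht₁
    have ht₁t : t₁ ≤ t := by
      rw [ht₁, div_le_iff₀ hm0]; nlinarith
    have hquot : t / t₁ = m := by
      rw [ht₁, div_div_eq_mul_div, mul_comm, mul_div_assoc, div_self ht.ne, mul_one]
    have h := hwin t₁ ht₁t R hR
    rw [hquot, ← hD] at h
    have hmpow : m ^ lam ≤ δ / (|D| + 1) := by
      have h1 : m ^ lam ≤ ((δ / (|D| + 1)) ^ (1 / lam)) ^ lam :=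
        Real.rpow_le_rpow hm0.le (min_le_left _ _) hlam.le
      rw [← Real.rpow_mul hq0.le, one_div_mul_cancel hlam.ne', Real.rpow_one] at h1
      exact h1
    have hmpow0 : 0 ≤ m ^ lam := Real.rpow_nonneg hm0.le _
    calc ∫ r in Ioo 0 R, netFlux (T t) x₀ r ≤ D * m ^ lam := h
      _ ≤ |D| * m ^ lam := by gcongr; exact le_abs_self D
      _ ≤ |D| * (δ / (|D| + 1)) := by gcongr
      _ ≤ δ := by
          rw [mul_div_assoc']
          rw [div_le_iff₀ (by positivity)]
          nlinarith [abs_nonneg D]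
  -- ### the density `r ↦ r·osc` is continuous, nonnegative and bounded on `(0,R)`: it vanishes
  have hTc : ContinuousOn (T t) {x₀}ᶜ :=
    (hsT.continuousOn.comp (continuous_const.prodMk continuous_id).continuousOn fun y hy =>
      mk_mem_prod (mem_Iio.2 ht) hy)
  have hTb' : ∀ y, |T t y| ≤ CT := fun y => hCT t ht y
  have hg0 : ∀ r, 0 < r → 0 ≤ netFlux (T t) x₀ r := fun r hr =>
    mul_nonneg hr.le (sphOsc_nonneg hTb' x₀ hr.le)
  have hgb : ∀ R, 0 < R → ∃ M, ∀ r ∈ Ioo 0 R, |netFlux (T t) x₀ r| ≤ M := by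
    intro R hR
    refine ⟨R * (2 * CT), fun r hr => ?_⟩
    rw [abs_of_nonneg (hg0 r hr.1)]
    unfold netFlux
    have hosc : sphOsc (T t) x₀ r ≤ 2 * CT := by
      obtain ⟨y, hy⟩ := sphere_nonempty x₀ hr.1.le
      have hne : (T t '' Metric.sphere x₀ r).Nonempty := ⟨_, mem_image_of_mem _ hy⟩
      have hsup : sphSup (T t) x₀ r ≤ CT := csSup_le hne (by rintro _ ⟨z, -, rfl⟩; exact le_of_abs_le (hTb' z))
      have hinf : -CT ≤ sphInf (T t) x₀ r := le_csInf hne (by rintro _ ⟨z, -, rfl⟩; exact neg_le_of_abs_le (hTb' z))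
      unfold sphOsc; linarith
    exact mul_le_mul hr.2.le hosc (sphOsc_nonneg hTb' x₀ hr.1.le) hR.le
  have hzero := eq_zero_of_setIntegral_nonpos hg0 (continuousOn_netFlux hTc) hgb hint
  -- ### `T t` is constant on every sphere about `x₀`
  have hrad : ∀ y z : E3, ‖y - x₀‖ = ‖z - x₀‖ → T t y = T t z := by
    intro y z hyz
    rcases (norm_nonneg (y - x₀)).eq_or_lt with h0 | hpos
    · have hy : y = x₀ := by rw [← sub_eq_zero, ← norm_eq_zero]; exact h0.symm
      have hz : z = x₀ := by rw [← sub_eq_zero, ← norm_eq_zero, ← hyz]; exact h0.symm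
      rw [hy, hz]
    · have hosc : sphOsc (T t) x₀ ‖y - x₀‖ = 0 := by
        have h := hzero ‖y - x₀‖ hpos
        unfold netFlux at h
        rcases mul_eq_zero.1 h with h | h
        · exact absurd h hpos.ne'
        · exact h
      exact sphere_const_of_sphOsc_eq_zero hTb' x₀ hosc (mem_sphere_iff_norm.2 rfl)
        (mem_sphere_iff_norm.2 hyz.symm)
  -- ### radial gradient
  have hTd : DifferentiableOn ℝ (T t) {x₀}ᶜ := by
    have h1 : ContDiffOn ℝ (⊤ : ℕ∞) (T t) {x₀}ᶜ :=
      hsT.comp (contDiffOn_const.prodMk contDiffOn_id) fun y hy => mk_mem_prod (mem_Iio.2 ht) hy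
    exact h1.differentiableOn (by simp)
  exact cross_gradient_eq_zero_of_sphere_const hTd hrad x

end Summit.NavierStokesRegularity.NavierStokesRegularity.Theorems.PoloidalLiouville.Indicatrix

end
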